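import Summits.ResolutionOfSingularities.ResolutionOfSingularities.Theorems.PurelyInseparableDim4ResConeLightPairPowerConeTailPrime
import Summits.ResolutionOfSingularities.ResolutionOfSingularities.Theorems.PurelyInseparableDim4ResConeCInfSharpEntryOfChainPrime
import Summits.ResolutionOfSingularities.ResolutionOfSingularities.Theorems.PurelyInseparableDim4SwapTransportWindowResidualSharpPrime
import HarnessLib
import HarnessLib.Audit.Tags

/-!
# Purely inseparable four-folds — THE LIGHT PAIR OF TAIL(p, p−1, 3) FOR p ≤ 7 IS IMPOSSIBLE, UNCONDITIONALLY: the DICHOTOMY on the chain's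
# Q-flag (cell `res-dim4-pi`, K2(p) lane, rung-1 POWER-CONE LINE «light pair of TAIL(p, p−1, 3)», final assembly of the flagged and the
# flagless branches)

[OURS · counted 0 · cell `res-dim4-pi` · K2(p) lane (holder res-dim4-p-12 g5); seat res-dim4-p-3 g6.]  Nothing here proves K2(7), K2(p) for any `p`,
TAIL(7, 6, 3) as a whole, `NoIsolatedTrap p p`, the Cossart–Jannsen–Saito theorem or resolution of singularities in dimension ≥ 4 / characteristic
`p` — NOT proved.  AI kernel work, weaker than expert review.  What IS proved here (`d + 1 = p`, `4 ≤ d ≤ 6`, i.e. `p ∈ {5, 7}`): an infinite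
all-isolated light-pair power-cone chain — isolated Step0 chain witnessed by `(j, b)`, `x^r ∣ F` at time `0`, order never `p`, and from some time on
shade `d`, `e_G = 3` and two boundary letters of weight one — DOES NOT EXIST.  At `p = 5` this re-proves res-dim4-p-3 g4's `ResCone.cInf_no_chain`
by the `∀ p` route; at `p = 7` it is the light pair `(1,1)+0` of TAIL(7, 6, 3), flagged AND flagless branches.

* §1 **`cInf_hE_of_chain_prime_of_chainFlag_r`**, **`cInf_no_chain_prime_of_chainFlag_r`** — ENTRY-5b / the conditional assembly
  (`…ResConeLightPairPowerConeTailPrime` p719634) with the per-chain Q-flag hypothesis WEAKENED to `hQc_r`: the flag is demanded only of framed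
  children whose labelling `π₀` names the real ledger, `(c (k′+1)).r = π₀ λ + π₀ μ` (ENTRY-5a `exists_cInf_framed_entry_at_prime` supplies exactly
  this; verbatim proof otherwise).  The point: the NEGATION of `hQc_r` hands the ♯-entry the ledger labelling its virtual chain needs.
* §2 **`no_light_pair_powerCone_tail_prime_of_le_six`** — THE DICHOTOMY: two weight-one letters ⇒ free tail (the free-tail lemma
  `FreeTailProof.noIsolatedFreeTailAt_self` kills it) or both letters born (`light_pair_dichotomy`); then `by_cases hQc_r`: the FLAGGED branch is
  §1 (res-dim4-typ-1 g5's window `SwapTransport.cInf_no_chain_of_entry_prime` behind it), the FLAGLESS branch is E5♯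
  `cInf_hE_sharp_of_chain_prime_of_not_chainFlag_r` feeding res-dim4-typ-1 g6's ♯-window `SwapTransport.cInf_no_chain_of_entry_sharp_prime` at
  row `0`, whose pinning hypothesis `hVT` is res-dim4-typ-1 g6's `sharp_pinning_row_prime` (over (B′) `translation_eq_zero_of_level`).
  DEPENDENCY HONESTY: the flagless branch uses `d ≤ 6` exactly once (♯4 `coeff_sharpFlag_ne_zero_of_isIsolated`: the isolation u-witness IS the
  ♯-flag only for `d ≤ 6`); `4 ≤ d` is the ♯-flag's room (`x_u^{d−2}` two levels above the dead row).  For `p ≥ 11` the level hierarchy of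
  res-dim4-p-3 g6's MEMO §7′ is OPEN.
[cite: CossartJannsenSaito2020, Thm. 3.14, Lemma 13.2] [cite: Hauser2010, §§F–G]
bears_on: LADDER-RESOLUTION:D157-DOOR2 (res-dim4-pi · K2(p) · power cones · light pair (1,1)+0 of TAIL(7,6,3) unconditional).  Supports
stmt-ResolutionOfSingularities-16155 (helper).
-/

set_option linter.dupNamespace false -- mandated namespace of this single-conjunct summit

noncomputable section

namespace Summit.ResolutionOfSingularities.ResolutionOfSingularities.Theorems.PIDim4

namespace ResCone

open MvPolynomial Finset FrameChange
open Literature.AlgebraicGeometry.Resolution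
open Literature.AlgebraicGeometry.Resolution.CentreBlowup
open Literature.AlgebraicGeometry.Resolution.Hauser2010
open Literature.AlgebraicGeometry.Resolution.HauserPerlega2019

variable {K : Type} [Field K] [DecidableEq K]

/-! ## 1. The per-chain Q-flag, ledger-labelled form -/

/-- **THE WINDOW'S ENTRY `hE` FROM THE CHAIN, every prime, MODULO THE LEDGER-LABELLED Q-FLAG `hQc_r`** (module docstring §1).
[OURS · CONDITIONAL] [cite: CossartJannsenSaito2020, Thm. 3.14, Lemma 13.2] -/
theorem cInf_hE_of_chain_prime_of_chainFlag_r (p : ℕ) [hp : Fact p.Prime] [CharP K p] {d : ℕ} (hdp : d + 1 = p)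
    (hd2 : 2 ≤ d)
    {c : ℕ → State K} {j : ℕ → Fin 4} {b : ℕ → Fin 4 → K}
    (hc : ∀ k, IsIsolated p (c k).F ∧ Step0 p (c k) (c (k + 1))) (hw : FreeTail.IsWitnessedChain p c j b)
    (hr0 : ∀ e ∈ (c 0).F.support, (c 0).r ≤ e) (hfloor : ∀ k, ordZero (c k).F ≠ (p : ℕ)) {k₀ : ℕ}
    (hshade : ∀ k, k₀ ≤ k → (c k).shade = ((d : ℕ) : ℕ∞))
    (he3 : ∀ k, k₀ ≤ k → Module.finrank K (resVertex (c k)) = 3) {k₁ : ℕ} (hk₁ : k₀ ≤ k₁)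
    (hwt : ∀ k, k₀ ≤ k → (∀ i, (c k).r i ≤ 1) ∧ (c k).r.degree = 2)
    (hborn : ∀ k, k₁ ≤ k → ∀ i, 1 ≤ (c k).r i →
      ∃ t, k₀ ≤ t ∧ t < k ∧ j t = i ∧ ∀ m, t < m → m < k → j m ≠ i ∧ b m i = 0)
    (hQc : ∀ k', k₁ ≤ k' → 1 ≤ k' → ∃ M₀ : ℕ, ∀ M, M₀ ≤ M →
      ∀ (la mu u f κ : Fin 4) (π₀ : Equiv.Perm (Fin 4)) (A₁ S₂ : State K) (Φ : MvPolynomial (Fin 4) K)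
        (θ' e' : Fin 4 → MvPolynomial (Fin 4) K) (U' E' : MvPolynomial (Fin 4) K) (a : K),
        la ≠ mu → la ≠ u → la ≠ f → mu ≠ u → mu ≠ f → u ≠ f → (κ = la ∨ κ = mu) →
        (c (k' + 1)).r = Finsupp.single (π₀ la) 1 + Finsupp.single (π₀ mu) 1 →
        θ' (π₀ la) = X la * e' la → θ' (π₀ mu) = X mu * e' mu → constantCoeff (e' la) ≠ 0 → constantCoeff (e' mu) ≠ 0 →
        constantCoeff (θ' (π₀ u)) = 0 → constantCoeff (θ' (π₀ f)) = 0 →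
        coeff (Finsupp.single u 1) (θ' (π₀ u)) * coeff (Finsupp.single f 1) (θ' (π₀ f)) -
          coeff (Finsupp.single f 1) (θ' (π₀ u)) * coeff (Finsupp.single u 1) (θ' (π₀ f)) ≠ 0 →
        constantCoeff U' ≠ 0 → E' ∈ originIdeal K ^ M → A₁.F = deletePthPowers p (U' ^ p * aeval θ' (c (k' + 1)).F) + E' →
        S₂.r = Finsupp.single la 1 + Finsupp.single mu 1 → (∀ e ∈ S₂.F.support, S₂.r ≤ e) →
        ordZero S₂.F = ((d + 2 : ℕ) : ℕ∞) → a ≠ 0 → resForm S₂ = C a * X f ^ d →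
        (∀ e ∈ S₂.F.support, e f ≤ d - 1 → 2 ≤ e la ∧ 2 ≤ e mu) →
        f ∉ Φ.vars → constantCoeff Φ = 0 →
        (CentreBlowup.step p Finset.univ κ 0 S₂).F = deletePthPowers p (tsch f Φ A₁.F) →
        ordZero (CentreBlowup.step p Finset.univ κ 0 S₂).F = ((d + 2 : ℕ) : ℕ∞) →
        IsIsolated p (CentreBlowup.step p Finset.univ κ 0 S₂).F →
        Module.finrank K (resVertex (CentreBlowup.step p Finset.univ κ 0 S₂)) = 3 →
        ∃ eu ef : ℕ, eu + ef = d - 2 ∧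
          coeff ((CentreBlowup.step p Finset.univ κ 0 S₂).r +
            (Finsupp.single la 1 + Finsupp.single mu 1 + Finsupp.single u (eu + 1) + Finsupp.single f ef))
            (CentreBlowup.step p Finset.univ κ 0 S₂).F ≠ 0) :
    ∀ k₂, ∃ k, k₂ ≤ k ∧ ∃ (la mu u f : Fin 4) (π₀ : Equiv.Perm (Fin 4)) (eu ef : ℕ),
      la ≠ mu ∧ la ≠ u ∧ la ≠ f ∧ mu ≠ u ∧ mu ≠ f ∧ u ≠ f ∧ eu + ef = d - 2 ∧
      (c k).r = Finsupp.single (π₀ la) 1 + Finsupp.single (π₀ mu) 1 ∧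
      ∀ M N : ℕ, ∃ B₀ : State K,
        (∃ (θ e : Fin 4 → MvPolynomial (Fin 4) K) (U E : MvPolynomial (Fin 4) K),
          θ (π₀ la) = X la * e la ∧ θ (π₀ mu) = X mu * e mu ∧ constantCoeff (e la) ≠ 0 ∧ constantCoeff (e mu) ≠ 0 ∧
          constantCoeff (θ (π₀ u)) = 0 ∧ constantCoeff (θ (π₀ f)) = 0 ∧
          coeff (Finsupp.single u 1) (θ (π₀ u)) * coeff (Finsupp.single f 1) (θ (π₀ f)) -
            coeff (Finsupp.single f 1) (θ (π₀ u)) * coeff (Finsupp.single u 1) (θ (π₀ f)) ≠ 0 ∧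
          constantCoeff U ≠ 0 ∧ E ∈ originIdeal K ^ M ∧ B₀.F = deletePthPowers p (U ^ p * aeval θ (c k).F) + E) ∧
        ordZero B₀.F = ((d + 2 : ℕ) : ℕ∞) ∧ B₀.r = Finsupp.single la 1 + Finsupp.single mu 1 ∧
        (∀ e ∈ B₀.F.support, B₀.r ≤ e) ∧ (∃ a : K, a ≠ 0 ∧ resForm B₀ = C a * X f ^ d) ∧
        (∀ e ∈ B₀.F.support, e f ≤ d - 1 → 2 ≤ e la ∧ 2 ≤ e mu) ∧
        (∀ e ∈ B₀.F.support, e.degree < N → ¬ (e u = eu ∧ e f = ef)) ∧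
        coeff (B₀.r + (Finsupp.single la 1 + Finsupp.single mu 1 + Finsupp.single u (eu + 1) + Finsupp.single f ef)) B₀.F ≠ 0 ∧
        IsIsolated p B₀.F ∧ Module.finrank K (resVertex B₀) = 3 := by
  intro k₂
  have hk'₁ : k₁ ≤ max k₂ (k₁ + 1) := (Nat.le_succ k₁).trans (le_max_right _ _)
  have hk'1 : 1 ≤ max k₂ (k₁ + 1) := le_trans (by omega) (le_max_right _ _)
  obtain ⟨la, mu, u, f, π₀, hlm, hlu, hlf, hmu, hmf, huf, hr, hdata⟩ :=
    exists_cInf_framed_entry_at_prime p hdp hd2 hc hw hr0 hfloor hshade he3 hk₁ hwt hborn hk'₁ hk'1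
  obtain ⟨M₀, hQ⟩ := hQc _ hk'₁ hk'1
  set k := max k₂ (k₁ + 1) + 1 with hk
  -- for every `n`: a flagged row of the framed child at precision `n + M₀`, and the window block there
  have hblock : ∀ n : ℕ, ∃ ef' : Fin (d - 1), ∃ eu : ℕ, eu + (ef' : ℕ) = d - 2 ∧ ∃ B₀ : State K,
      (∃ (θ e : Fin 4 → MvPolynomial (Fin 4) K) (U E : MvPolynomial (Fin 4) K),
        θ (π₀ la) = X la * e la ∧ θ (π₀ mu) = X mu * e mu ∧ constantCoeff (e la) ≠ 0 ∧ constantCoeff (e mu) ≠ 0 ∧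
        constantCoeff (θ (π₀ u)) = 0 ∧ constantCoeff (θ (π₀ f)) = 0 ∧
        coeff (Finsupp.single u 1) (θ (π₀ u)) * coeff (Finsupp.single f 1) (θ (π₀ f)) -
          coeff (Finsupp.single f 1) (θ (π₀ u)) * coeff (Finsupp.single u 1) (θ (π₀ f)) ≠ 0 ∧
        constantCoeff U ≠ 0 ∧ E ∈ originIdeal K ^ (n + M₀) ∧ B₀.F = deletePthPowers p (U ^ p * aeval θ (c k).F) + E) ∧
      ordZero B₀.F = ((d + 2 : ℕ) : ℕ∞) ∧ B₀.r = Finsupp.single la 1 + Finsupp.single mu 1 ∧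
      (∀ e ∈ B₀.F.support, B₀.r ≤ e) ∧ (∃ a : K, a ≠ 0 ∧ resForm B₀ = C a * X f ^ d) ∧
      (∀ e ∈ B₀.F.support, e f ≤ d - 1 → 2 ≤ e la ∧ 2 ≤ e mu) ∧
      (∀ e ∈ B₀.F.support, e.degree < n + M₀ → ¬ (e u = eu ∧ e f = (ef' : ℕ))) ∧
      coeff (B₀.r + (Finsupp.single la 1 + Finsupp.single mu 1 + Finsupp.single u (eu + 1) +
        Finsupp.single f (ef' : ℕ))) B₀.F ≠ 0 ∧
      IsIsolated p B₀.F ∧ Module.finrank K (resVertex B₀) = 3 := by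
    intro n
    obtain ⟨κ, A₁, S₂, C₁, Φ, θ', e', U', E', a, hκ, h1, h2, h3, h4, h5, h6, h7, h8, h9, h10, hC₁, hrS₂, hdivS₂, hoS₂, ha,
        hresS₂, hledS₂, hΦvars, hΦ0, hC₁F, hoC₁, hrC₁, hdivC₁, hresC₁, hledC₁, hisoC₁, he3C₁⟩ := hdata (n + M₀)
    obtain ⟨eu, ef, hef, hV⟩ := hQ (n + M₀) (by omega) la mu u f κ π₀ A₁ S₂ Φ θ' e' U' E' a hlm hlu hlf hmu hmf huf hκ
      hr h1 h2 h3 h4 h5 h6 h7 h8 h9 h10 hrS₂ hdivS₂ hoS₂ ha hresS₂ hledS₂ hΦvars hΦ0 (by rw [← hC₁]; exact hC₁F)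
      (by rw [← hC₁]; exact hoC₁) (by rw [← hC₁]; exact hisoC₁) (by rw [← hC₁]; exact he3C₁)
    rw [← hC₁] at hV
    obtain ⟨B₀, hB⟩ := exists_cInf_virtual_entry_of_rel_prime p hdp hd2 hef hlm hlu hlf hmu hmf huf h1 h2 h3 h4 h5 h6 h7
      h8 h9 h10 hΦvars hΦ0 hC₁F hoC₁ hrC₁ hdivC₁ ha hresC₁ hledC₁ hisoC₁ he3C₁ hV (n + M₀)
    exact ⟨⟨ef, by omega⟩, eu, hef, B₀, hB⟩
  choose ρ hρ using hblock
  -- one row serves infinitely many precisions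
  obtain ⟨ef₀, hinf⟩ := Finite.exists_infinite_fiber ρ
  have hinf' : (ρ ⁻¹' {ef₀}).Infinite := Set.infinite_coe_iff.mp hinf
  refine ⟨k, (le_max_left _ _).trans (Nat.le_succ _), la, mu, u, f, π₀, d - 2 - (ef₀ : ℕ), (ef₀ : ℕ), hlm, hlu, hlf, hmu,
    hmf, huf, by have := ef₀.isLt; omega, hr, fun M N => ?_⟩
  obtain ⟨n, hn, hMN⟩ := hinf'.exists_gt (max M N)
  have hρn : ρ n = ef₀ := hn
  obtain ⟨eu, heu, B₀, ⟨θ, e, U, E, h1, h2, h3, h4, h5, h6, h7, h8, h9, h10⟩, ho, hrB, hdiv, hres, hled, hrow, hV, hiso,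
    he3B⟩ := hρ n
  rw [hρn] at heu hrow hV
  obtain rfl : eu = d - 2 - (ef₀ : ℕ) := by omega
  exact ⟨B₀, ⟨θ, e, U, E, h1, h2, h3, h4, h5, h6, h7, h8, Ideal.pow_le_pow_right (by omega) h9, h10⟩, ho, hrB, hdiv, hres,
    hled, fun e' he' hlt => hrow e' he' (lt_of_lt_of_le hlt (by omega)), hV, hiso, he3B⟩


/-- **THE C∞ CONFIGURATION IS IMPOSSIBLE FOR EVERY PRIME, MODULO THE LEDGER-LABELLED Q-FLAG `hQc_r`** (module docstring §1).
[OURS · CONDITIONAL] [cite: CossartJannsenSaito2020, Thm. 3.14] -/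
theorem cInf_no_chain_prime_of_chainFlag_r (p : ℕ) [hp : Fact p.Prime] [CharP K p] {d : ℕ} (hdp : d + 1 = p) (hd2 : 2 ≤ d)
    {c : ℕ → State K} {j : ℕ → Fin 4} {b : ℕ → Fin 4 → K}
    (hc : ∀ k, IsIsolated p (c k).F ∧ Step0 p (c k) (c (k + 1))) (hw : FreeTail.IsWitnessedChain p c j b)
    (hr0 : ∀ e ∈ (c 0).F.support, (c 0).r ≤ e) (hfloor : ∀ k, ordZero (c k).F ≠ (p : ℕ)) {k₀ : ℕ}
    (hshade : ∀ k, k₀ ≤ k → (c k).shade = ((d : ℕ) : ℕ∞))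
    (he3 : ∀ k, k₀ ≤ k → Module.finrank K (resVertex (c k)) = 3) {k₁ : ℕ} (hk₁ : k₀ ≤ k₁)
    (hwt : ∀ k, k₀ ≤ k → (∀ i, (c k).r i ≤ 1) ∧ (c k).r.degree = 2)
    (hborn : ∀ k, k₁ ≤ k → ∀ i, 1 ≤ (c k).r i →
      ∃ t, k₀ ≤ t ∧ t < k ∧ j t = i ∧ ∀ m, t < m → m < k → j m ≠ i ∧ b m i = 0)
    (hQc : ∀ k', k₁ ≤ k' → 1 ≤ k' → ∃ M₀ : ℕ, ∀ M, M₀ ≤ M →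
      ∀ (la mu u f κ : Fin 4) (π₀ : Equiv.Perm (Fin 4)) (A₁ S₂ : State K) (Φ : MvPolynomial (Fin 4) K)
        (θ' e' : Fin 4 → MvPolynomial (Fin 4) K) (U' E' : MvPolynomial (Fin 4) K) (a : K),
        la ≠ mu → la ≠ u → la ≠ f → mu ≠ u → mu ≠ f → u ≠ f → (κ = la ∨ κ = mu) →
        (c (k' + 1)).r = Finsupp.single (π₀ la) 1 + Finsupp.single (π₀ mu) 1 →
        θ' (π₀ la) = X la * e' la → θ' (π₀ mu) = X mu * e' mu → constantCoeff (e' la) ≠ 0 → constantCoeff (e' mu) ≠ 0 →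
        constantCoeff (θ' (π₀ u)) = 0 → constantCoeff (θ' (π₀ f)) = 0 →
        coeff (Finsupp.single u 1) (θ' (π₀ u)) * coeff (Finsupp.single f 1) (θ' (π₀ f)) -
          coeff (Finsupp.single f 1) (θ' (π₀ u)) * coeff (Finsupp.single u 1) (θ' (π₀ f)) ≠ 0 →
        constantCoeff U' ≠ 0 → E' ∈ originIdeal K ^ M → A₁.F = deletePthPowers p (U' ^ p * aeval θ' (c (k' + 1)).F) + E' →
        S₂.r = Finsupp.single la 1 + Finsupp.single mu 1 → (∀ e ∈ S₂.F.support, S₂.r ≤ e) →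
        ordZero S₂.F = ((d + 2 : ℕ) : ℕ∞) → a ≠ 0 → resForm S₂ = C a * X f ^ d →
        (∀ e ∈ S₂.F.support, e f ≤ d - 1 → 2 ≤ e la ∧ 2 ≤ e mu) →
        f ∉ Φ.vars → constantCoeff Φ = 0 →
        (CentreBlowup.step p Finset.univ κ 0 S₂).F = deletePthPowers p (tsch f Φ A₁.F) →
        ordZero (CentreBlowup.step p Finset.univ κ 0 S₂).F = ((d + 2 : ℕ) : ℕ∞) →
        IsIsolated p (CentreBlowup.step p Finset.univ κ 0 S₂).F →
        Module.finrank K (resVertex (CentreBlowup.step p Finset.univ κ 0 S₂)) = 3 →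
        ∃ eu ef : ℕ, eu + ef = d - 2 ∧
          coeff ((CentreBlowup.step p Finset.univ κ 0 S₂).r +
            (Finsupp.single la 1 + Finsupp.single mu 1 + Finsupp.single u (eu + 1) + Finsupp.single f ef))
            (CentreBlowup.step p Finset.univ κ 0 S₂).F ≠ 0) : False :=
  SwapTransport.cInf_no_chain_of_entry_prime p hdp hd2 hc hw hr0 hfloor hshade he3 hwt
    (cInf_hE_of_chain_prime_of_chainFlag_r p hdp hd2 hc hw hr0 hfloor hshade he3 hk₁ hwt hborn hQc)

/-! ## 2. The dichotomy -/

/-- **NO LIGHT-PAIR POWER-CONE TAIL AT `(p, p − 1)` FOR `p ≤ 7`, UNCONDITIONALLY** (module docstring §2): for `d + 1 = p`, `4 ≤ d ≤ 6`, an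
infinite all-isolated witnessed Step0 chain with `x^r ∣ F` at time `0`, order never `p`, and — from some time `k₀` on — shade `d`, `e_G = 3` and two
boundary letters of weight one does not exist. [OURS] [cite: CossartJannsenSaito2020, Thm. 3.14, Lemma 13.2] [cite: Hauser2010, §§F–G] -/
theorem no_light_pair_powerCone_tail_prime_of_le_six (p : ℕ) [hp : Fact p.Prime] [CharP K p] {d : ℕ} (hdp : d + 1 = p) (hd4 : 4 ≤ d)
    (hd6 : d ≤ 6) {c : ℕ → State K} {j : ℕ → Fin 4} {b : ℕ → Fin 4 → K}
    (hc : ∀ k, IsIsolated p (c k).F ∧ Step0 p (c k) (c (k + 1))) (hw : FreeTail.IsWitnessedChain p c j b)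
    (hr0 : ∀ e ∈ (c 0).F.support, (c 0).r ≤ e) (hfloor : ∀ k, ordZero (c k).F ≠ (p : ℕ)) {k₀ : ℕ}
    (hshade : ∀ k, k₀ ≤ k → (c k).shade = ((d : ℕ) : ℕ∞))
    (he3 : ∀ k, k₀ ≤ k → Module.finrank K (resVertex (c k)) = 3)
    (hwt : ∀ k, k₀ ≤ k → (∀ i, (c k).r i ≤ 1) ∧ (c k).r.degree = 2) : False := by
  have hd2 : 2 ≤ d := by omega
  -- two alive letters of weight one
  have hB2 : ∀ k, k₀ ≤ k → (c k).r.support.card = 2 := fun k hk => by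
    have hval : ∀ i ∈ (c k).r.support, (c k).r i = 1 := fun i hi => by
      have := (hwt k hk).1 i; have := Finsupp.mem_support_iff.mp hi; omega
    have h : (c k).r.degree = ∑ i ∈ (c k).r.support, (c k).r i := rfl
    rw [(hwt k hk).2, Finset.sum_congr rfl hval, Finset.sum_const, smul_eq_mul, mul_one] at h
    omega
  rcases light_pair_dichotomy p hc hw hfloor hB2 with ⟨k₁, -, hfree⟩ | ⟨k₁, hk₁, hborn⟩
  · -- a free tail is not isolated
    obtain ⟨k, hk⟩ := FreeTailProof.noIsolatedFreeTailAt_self p K c j b k₁ hw hfree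
    exact hk (hc k).1
  · -- both letters born: the dichotomy on the ledger-labelled per-chain Q-flag
    rcases Classical.em (∀ k', k₁ ≤ k' → 1 ≤ k' → ∃ M₀ : ℕ, ∀ M, M₀ ≤ M →
      ∀ (la mu u f κ : Fin 4) (π₀ : Equiv.Perm (Fin 4)) (A₁ S₂ : State K) (Φ : MvPolynomial (Fin 4) K)
        (θ' e' : Fin 4 → MvPolynomial (Fin 4) K) (U' E' : MvPolynomial (Fin 4) K) (a : K),
        la ≠ mu → la ≠ u → la ≠ f → mu ≠ u → mu ≠ f → u ≠ f → (κ = la ∨ κ = mu) →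
        (c (k' + 1)).r = Finsupp.single (π₀ la) 1 + Finsupp.single (π₀ mu) 1 →
        θ' (π₀ la) = X la * e' la → θ' (π₀ mu) = X mu * e' mu → constantCoeff (e' la) ≠ 0 → constantCoeff (e' mu) ≠ 0 →
        constantCoeff (θ' (π₀ u)) = 0 → constantCoeff (θ' (π₀ f)) = 0 →
        coeff (Finsupp.single u 1) (θ' (π₀ u)) * coeff (Finsupp.single f 1) (θ' (π₀ f)) -
          coeff (Finsupp.single f 1) (θ' (π₀ u)) * coeff (Finsupp.single u 1) (θ' (π₀ f)) ≠ 0 →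
        constantCoeff U' ≠ 0 → E' ∈ originIdeal K ^ M → A₁.F = deletePthPowers p (U' ^ p * aeval θ' (c (k' + 1)).F) + E' →
        S₂.r = Finsupp.single la 1 + Finsupp.single mu 1 → (∀ e ∈ S₂.F.support, S₂.r ≤ e) →
        ordZero S₂.F = ((d + 2 : ℕ) : ℕ∞) → a ≠ 0 → resForm S₂ = C a * X f ^ d →
        (∀ e ∈ S₂.F.support, e f ≤ d - 1 → 2 ≤ e la ∧ 2 ≤ e mu) →
        f ∉ Φ.vars → constantCoeff Φ = 0 →
        (CentreBlowup.step p Finset.univ κ 0 S₂).F = deletePthPowers p (tsch f Φ A₁.F) →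
        ordZero (CentreBlowup.step p Finset.univ κ 0 S₂).F = ((d + 2 : ℕ) : ℕ∞) →
        IsIsolated p (CentreBlowup.step p Finset.univ κ 0 S₂).F →
        Module.finrank K (resVertex (CentreBlowup.step p Finset.univ κ 0 S₂)) = 3 →
        ∃ eu ef : ℕ, eu + ef = d - 2 ∧
          coeff ((CentreBlowup.step p Finset.univ κ 0 S₂).r +
            (Finsupp.single la 1 + Finsupp.single mu 1 + Finsupp.single u (eu + 1) + Finsupp.single f ef))
            (CentreBlowup.step p Finset.univ κ 0 S₂).F ≠ 0) with hQc | hQc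
    · exact cInf_no_chain_prime_of_chainFlag_r p hdp hd2 hc hw hr0 hfloor hshade he3 hk₁ hwt hborn hQc
    · push Not at hQc
      obtain ⟨k', hk', -, hnQ⟩ := hQc
      exact SwapTransport.cInf_no_chain_of_entry_sharp_prime p hdp (ef := 0) (by omega)
        (fun x y u f B β hxy hxu hxf hyu hyf huf ho hR hcross hg hchild =>
          sharp_pinning_row_prime hxy hxu hxf hyu hyf huf p hdp (by omega) B β ho hR hcross hg hchild)
        hc hw hr0 hfloor hshade he3 hwt
        (cInf_hE_sharp_of_chain_prime_of_not_chainFlag_r p hdp hd4 hd6 hc hw hr0 hfloor hshade he3 hwt (hk₁.trans hk') hnQ)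

end ResCone

end Summit.ResolutionOfSingularities.ResolutionOfSingularities.Theorems.PIDim4
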